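import Summits.Ventures.Crystal3D.Theorems.StickyWulffConstantCoaxialWallLawTranslateAbsorption
import Summits.Ventures.Crystal3D.Theorems.StickyWulffConstantCoaxialWallLawTwinLedgerSum
import Summits.Ventures.Crystal3D.Theorems.StickyWulffConstantCoaxialWallLawRiserCountTop
import HarnessLib

/-!
# The translation-pair slot ledger: in-plane vacancies of both grains are bounded by `8·D(X)`

HONEST FRAMING. Part of the venture `Summits/Ventures/Crystal3D` (cell `crystal3d-full`), helper
`--supports` the crux `CoaxialWallLaw` (stmt-Ventures-19481, `route-Ventures-StickyWulffConstant`),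
REGISTERED line `WallLedgerF` (planner cf-p1 gen 16), stub `stub_coaxialTwoSlabAdhesion`
(terrace/riser slot ledger, RIGID rung), TRANSLATION pairs `M·Λ₀ + t`, `M·Λ₀ + t'` (grains
disjoint, every ball on one of them), under the AXIS RULE hypothesis of
`…CoaxialWallLawTranslateAbsorption` for both pulled-back offsets `M⁻¹(t' − t)`, `M⁻¹(t − t')`:

* `translate_inPlane_vacancies_le_eight_deficiency` — the twelve riser-count terms add up to at
  most `8 · contactDeficiency X` (sum of `translate_absorption_inPlane_moved` over both grains);
* `coaxial_rigid_translate_wall_term` — under the crux's literal co-axiality hypotheses with EQUAL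
  words (`σ 0 = σ' 0`), disjoint grains, `X ⊆ Λ₁ ∪ Λ₂` and the two axis hypotheses on the frame
  the words select (`L` or `L ∘ R`): `2(√6 sin θ · πρ² − 3√2π(6R₀+16)(1+h)ρ) ≤ 8 · D(X)`.

WHAT THIS IS NOT: the choice of the adapted axis (the crux lets the defender choose `L`; that a
suitable choice always satisfies the axis hypotheses is not proved here), coincidence sites, the
outer-face bookkeeping of the stub; rung F-C1 not moved.
-/

noncomputable section

namespace Summit.Ventures.Crystal3D.Theorems

open Summit.Ventures.Crystal3D Finset
open Literature.MathematicalPhysics.StatisticalMechanics (fccStacking barlowStacking IsHaggSeq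
  contactDeficiency orderedContacts triangularVec₁ triangularVec₂ sum_card_filter_dist_eq_orderedContacts)
open scoped InnerProductSpace

/-- **The translation-pair slot ledger.**  See the module docstring. -/
theorem translate_inPlane_vacancies_le_eight_deficiency
    (M : EuclideanSpace ℝ (Fin 3) ≃ₗᵢ[ℝ] EuclideanSpace ℝ (Fin 3)) (t t' : EuclideanSpace ℝ (Fin 3))
    [DecidablePred fun p : EuclideanSpace ℝ (Fin 3) => p ∈ (fun q => M q + t) '' fccStacking 1 (Real.sqrt (2 / 3))]
    [DecidablePred fun p : EuclideanSpace ℝ (Fin 3) => p ∈ (fun q => M q + t') '' fccStacking 1 (Real.sqrt (2 / 3))]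
    (X : Finset (EuclideanSpace ℝ (Fin 3)))
    (hX : ∀ p ∈ X, ∀ q ∈ X, p ≠ q → 1 ≤ dist p q)
    (hXΛ : ∀ p ∈ X, p ∈ (fun q => M q + t) '' fccStacking 1 (Real.sqrt (2 / 3)) ∨
      p ∈ (fun q => M q + t') '' fccStacking 1 (Real.sqrt (2 / 3)))
    (hdisj : ∀ p ∈ (fun q => M q + t) '' fccStacking 1 (Real.sqrt (2 / 3)),
      p ∉ (fun q => M q + t') '' fccStacking 1 (Real.sqrt (2 / 3)))
    (haxis : ∀ w₁ ∈ fccSlots, ∀ w₂ ∈ fccSlots, ∀ w₃ ∈ fccSlots,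
      dist w₁ w₂ = 1 → dist w₁ w₃ = 1 → dist w₂ w₃ = 1 → w₁ 2 = 0 →
      (2 / 3 : ℝ) • (w₁ + w₂ + w₃) - M.symm (t' - t) ∉ fccStacking 1 (Real.sqrt (2 / 3)))
    (haxis' : ∀ w₁ ∈ fccSlots, ∀ w₂ ∈ fccSlots, ∀ w₃ ∈ fccSlots,
      dist w₁ w₂ = 1 → dist w₁ w₃ = 1 → dist w₂ w₃ = 1 → w₁ 2 = 0 →
      (2 / 3 : ℝ) • (w₁ + w₂ + w₃) - M.symm (t - t') ∉ fccStacking 1 (Real.sqrt (2 / 3))) :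
    (((((X.filter fun p => p ∈ (fun q => M q + t) '' fccStacking 1 (Real.sqrt (2 / 3)))).filter
          fun p => p + M (triangularVec₁ 1) ∉ X).card : ℝ) +
      ((((X.filter fun p => p ∈ (fun q => M q + t) '' fccStacking 1 (Real.sqrt (2 / 3)))).filter
          fun p => p - M (triangularVec₁ 1) ∉ X).card : ℝ) +
      ((((X.filter fun p => p ∈ (fun q => M q + t) '' fccStacking 1 (Real.sqrt (2 / 3)))).filter
          fun p => p + M (triangularVec₂ 1) ∉ X).card : ℝ) +
      ((((X.filter fun p => p ∈ (fun q => M q + t) '' fccStacking 1 (Real.sqrt (2 / 3)))).filter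
          fun p => p - M (triangularVec₂ 1) ∉ X).card : ℝ) +
      ((((X.filter fun p => p ∈ (fun q => M q + t) '' fccStacking 1 (Real.sqrt (2 / 3)))).filter
          fun p => p + M (triangularVec₂ 1 - triangularVec₁ 1) ∉ X).card : ℝ) +
      ((((X.filter fun p => p ∈ (fun q => M q + t) '' fccStacking 1 (Real.sqrt (2 / 3)))).filter
          fun p => p - M (triangularVec₂ 1 - triangularVec₁ 1) ∉ X).card : ℝ)) +
    (((((X.filter fun p => p ∈ (fun q => M q + t') '' fccStacking 1 (Real.sqrt (2 / 3)))).filter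
          fun p => p + M (triangularVec₁ 1) ∉ X).card : ℝ) +
      ((((X.filter fun p => p ∈ (fun q => M q + t') '' fccStacking 1 (Real.sqrt (2 / 3)))).filter
          fun p => p - M (triangularVec₁ 1) ∉ X).card : ℝ) +
      ((((X.filter fun p => p ∈ (fun q => M q + t') '' fccStacking 1 (Real.sqrt (2 / 3)))).filter
          fun p => p + M (triangularVec₂ 1) ∉ X).card : ℝ) +
      ((((X.filter fun p => p ∈ (fun q => M q + t') '' fccStacking 1 (Real.sqrt (2 / 3)))).filter
          fun p => p - M (triangularVec₂ 1) ∉ X).card : ℝ) +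
      ((((X.filter fun p => p ∈ (fun q => M q + t') '' fccStacking 1 (Real.sqrt (2 / 3)))).filter
          fun p => p + M (triangularVec₂ 1 - triangularVec₁ 1) ∉ X).card : ℝ) +
      ((((X.filter fun p => p ∈ (fun q => M q + t') '' fccStacking 1 (Real.sqrt (2 / 3)))).filter
          fun p => p - M (triangularVec₂ 1 - triangularVec₁ 1) ∉ X).card : ℝ)) ≤
      8 * contactDeficiency X := by
  classical
  have h₁ : ∀ x ∈ (X.filter fun p => p ∈ (fun q => M q + t) '' fccStacking 1 (Real.sqrt (2 / 3))),
      ((if x + M (triangularVec₁ 1) ∉ X then 1 else 0) + (if x - M (triangularVec₁ 1) ∉ X then 1 else 0) +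
      (if x + M (triangularVec₂ 1) ∉ X then 1 else 0) + (if x - M (triangularVec₂ 1) ∉ X then 1 else 0) +
      (if x + M (triangularVec₂ 1 - triangularVec₁ 1) ∉ X then 1 else 0) + (if x - M (triangularVec₂ 1 - triangularVec₁ 1) ∉ X then 1 else 0)) +
      4 * (X.filter fun y => dist x y = 1).card ≤ 48 := by
    intro x hx
    obtain ⟨-, hxG⟩ := mem_filter.1 hx
    rw [← inPlane_filter_card_eq_six M X x]
    exact translate_absorption_inPlane_moved M t t' X hX hXΛ x hxG (hdisj x hxG) haxis
  have h₂ : ∀ x ∈ (X.filter fun p => p ∈ (fun q => M q + t') '' fccStacking 1 (Real.sqrt (2 / 3))),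
      ((if x + M (triangularVec₁ 1) ∉ X then 1 else 0) + (if x - M (triangularVec₁ 1) ∉ X then 1 else 0) +
      (if x + M (triangularVec₂ 1) ∉ X then 1 else 0) + (if x - M (triangularVec₂ 1) ∉ X then 1 else 0) +
      (if x + M (triangularVec₂ 1 - triangularVec₁ 1) ∉ X then 1 else 0) + (if x - M (triangularVec₂ 1 - triangularVec₁ 1) ∉ X then 1 else 0)) +
      4 * (X.filter fun y => dist x y = 1).card ≤ 48 := by
    intro x hx
    obtain ⟨-, hxG⟩ := mem_filter.1 hx
    have hxG₁ : x ∉ (fun q => M q + t) '' fccStacking 1 (Real.sqrt (2 / 3)) := fun h1 => hdisj x h1 hxG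
    rw [← inPlane_filter_card_eq_six M X x]
    exact translate_absorption_inPlane_moved M t' t X hX (fun p hp => (hXΛ p hp).symm) x hxG hxG₁ haxis'
  -- the two grains partition `X`
  have hunion : (X.filter fun p => p ∈ (fun q => M q + t) '' fccStacking 1 (Real.sqrt (2 / 3))) ∪ (X.filter fun p => p ∈ (fun q => M q + t') '' fccStacking 1 (Real.sqrt (2 / 3))) = X := by
    ext p
    simp only [mem_union, mem_filter]
    constructor
    · rintro (⟨hp, -⟩ | ⟨hp, -⟩) <;> exact hp
    · intro hp
      rcases hXΛ p hp with h | h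
      · exact Or.inl ⟨hp, h⟩
      · exact Or.inr ⟨hp, h⟩
  have hdj : Disjoint (X.filter fun p => p ∈ (fun q => M q + t) '' fccStacking 1 (Real.sqrt (2 / 3))) (X.filter fun p => p ∈ (fun q => M q + t') '' fccStacking 1 (Real.sqrt (2 / 3))) := by
    rw [disjoint_filter]
    exact fun p _ h1 h2 => hdisj p h1 h2
  have hdeg : ∑ x ∈ X, (X.filter fun y => dist x y = 1).card = orderedContacts X :=
    sum_card_filter_dist_eq_orderedContacts X
  have hsum₁ := sum_le_sum h₁
  have hsum₂ := sum_le_sum h₂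
  simp only [sum_add_distrib, sum_const, smul_eq_mul, ← card_filter] at hsum₁ hsum₂
  rw [← mul_sum] at hsum₁ hsum₂
  have hdeg' : ∑ x ∈ (X.filter fun p => p ∈ (fun q => M q + t) '' fccStacking 1 (Real.sqrt (2 / 3))), (X.filter fun y => dist x y = 1).card +
      ∑ x ∈ (X.filter fun p => p ∈ (fun q => M q + t') '' fccStacking 1 (Real.sqrt (2 / 3))), (X.filter fun y => dist x y = 1).card = orderedContacts X := by
    rw [← sum_union hdj, hunion, hdeg]
  have hcard : (X.filter fun p => p ∈ (fun q => M q + t) '' fccStacking 1 (Real.sqrt (2 / 3))).card + (X.filter fun p => p ∈ (fun q => M q + t') '' fccStacking 1 (Real.sqrt (2 / 3))).card = X.card := by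
    rw [← card_union_of_disjoint hdj, hunion]
  have hD : 8 * contactDeficiency X = 48 * (X.card : ℝ) - 4 * (orderedContacts X : ℝ) := by
    rw [contactDeficiency]; ring
  rw [hD]
  have h1r : ((((X.filter fun p => p ∈ (fun q => M q + t) '' fccStacking 1 (Real.sqrt (2 / 3))).filter fun x => x + M (triangularVec₁ 1) ∉ X).card : ℕ) : ℝ) +
      ((((X.filter fun p => p ∈ (fun q => M q + t) '' fccStacking 1 (Real.sqrt (2 / 3))).filter fun x => x - M (triangularVec₁ 1) ∉ X).card : ℕ) : ℝ) +
      ((((X.filter fun p => p ∈ (fun q => M q + t) '' fccStacking 1 (Real.sqrt (2 / 3))).filter fun x => x + M (triangularVec₂ 1) ∉ X).card : ℕ) : ℝ) +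
      ((((X.filter fun p => p ∈ (fun q => M q + t) '' fccStacking 1 (Real.sqrt (2 / 3))).filter fun x => x - M (triangularVec₂ 1) ∉ X).card : ℕ) : ℝ) +
      ((((X.filter fun p => p ∈ (fun q => M q + t) '' fccStacking 1 (Real.sqrt (2 / 3))).filter fun x => x + M (triangularVec₂ 1 - triangularVec₁ 1) ∉ X).card : ℕ) : ℝ) +
      ((((X.filter fun p => p ∈ (fun q => M q + t) '' fccStacking 1 (Real.sqrt (2 / 3))).filter fun x => x - M (triangularVec₂ 1 - triangularVec₁ 1) ∉ X).card : ℕ) : ℝ) +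
      4 * ((∑ x ∈ (X.filter fun p => p ∈ (fun q => M q + t) '' fccStacking 1 (Real.sqrt (2 / 3))), (X.filter fun y => dist x y = 1).card : ℕ) : ℝ) ≤
      ((X.filter fun p => p ∈ (fun q => M q + t) '' fccStacking 1 (Real.sqrt (2 / 3))).card : ℝ) * 48 := by
    exact_mod_cast hsum₁
  have h2r : ((((X.filter fun p => p ∈ (fun q => M q + t') '' fccStacking 1 (Real.sqrt (2 / 3))).filter fun x => x + M (triangularVec₁ 1) ∉ X).card : ℕ) : ℝ) +
      ((((X.filter fun p => p ∈ (fun q => M q + t') '' fccStacking 1 (Real.sqrt (2 / 3))).filter fun x => x - M (triangularVec₁ 1) ∉ X).card : ℕ) : ℝ) +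
      ((((X.filter fun p => p ∈ (fun q => M q + t') '' fccStacking 1 (Real.sqrt (2 / 3))).filter fun x => x + M (triangularVec₂ 1) ∉ X).card : ℕ) : ℝ) +
      ((((X.filter fun p => p ∈ (fun q => M q + t') '' fccStacking 1 (Real.sqrt (2 / 3))).filter fun x => x - M (triangularVec₂ 1) ∉ X).card : ℕ) : ℝ) +
      ((((X.filter fun p => p ∈ (fun q => M q + t') '' fccStacking 1 (Real.sqrt (2 / 3))).filter fun x => x + M (triangularVec₂ 1 - triangularVec₁ 1) ∉ X).card : ℕ) : ℝ) +
      ((((X.filter fun p => p ∈ (fun q => M q + t') '' fccStacking 1 (Real.sqrt (2 / 3))).filter fun x => x - M (triangularVec₂ 1 - triangularVec₁ 1) ∉ X).card : ℕ) : ℝ) +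
      4 * ((∑ x ∈ (X.filter fun p => p ∈ (fun q => M q + t') '' fccStacking 1 (Real.sqrt (2 / 3))), (X.filter fun y => dist x y = 1).card : ℕ) : ℝ) ≤
      ((X.filter fun p => p ∈ (fun q => M q + t') '' fccStacking 1 (Real.sqrt (2 / 3))).card : ℝ) * 48 := by
    exact_mod_cast hsum₂
  have hdegr : ((∑ x ∈ (X.filter fun p => p ∈ (fun q => M q + t) '' fccStacking 1 (Real.sqrt (2 / 3))), (X.filter fun y => dist x y = 1).card : ℕ) : ℝ) +
      ((∑ x ∈ (X.filter fun p => p ∈ (fun q => M q + t') '' fccStacking 1 (Real.sqrt (2 / 3))), (X.filter fun y => dist x y = 1).card : ℕ) : ℝ) = (orderedContacts X : ℝ) := by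
    exact_mod_cast hdeg'
  have hcardr : ((X.filter fun p => p ∈ (fun q => M q + t) '' fccStacking 1 (Real.sqrt (2 / 3))).card : ℝ) + ((X.filter fun p => p ∈ (fun q => M q + t') '' fccStacking 1 (Real.sqrt (2 / 3))).card : ℝ) = (X.card : ℝ) := by
    exact_mod_cast hcard
  linarith


/-- **The wall term of the rigid translation-pair rung (disjoint grains, axis rule as hypothesis).**
Under the crux's literal co-axiality hypotheses for both grains with both words in the fcc letter
at `0` (`σ 0 = σ' 0 = 1`; the case `σ 0 = σ' 0 = −1` is the same statement for the frame `L ∘ R`,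
which presents the same grains with `+1` words and has the same axis `L e₃`), grains disjoint,
`X ⊆ Λ₁ ∪ Λ₂` a unit packing containing the two complete clamped slabs, and the axis hypotheses
for the pulled-back offsets `L⁻¹(s₂ − s₁)`, `L⁻¹(s₁ − s₂)`:
`2 · (√6 · √(1 − ⟪L e₃, e₃⟫²) · πρ² − 3√2π(6R₀+16)(1+h)ρ) ≤ 8 · D(X)`. -/
theorem coaxial_rigid_translate_wall_term
    (A₁ : EuclideanSpace ℝ (Fin 3) ≃ₗᵢ[ℝ] EuclideanSpace ℝ (Fin 3)) (t₁ : EuclideanSpace ℝ (Fin 3))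
    (A₂ : EuclideanSpace ℝ (Fin 3) ≃ₗᵢ[ℝ] EuclideanSpace ℝ (Fin 3)) (t₂ : EuclideanSpace ℝ (Fin 3))
    (L : EuclideanSpace ℝ (Fin 3) ≃ₗᵢ[ℝ] EuclideanSpace ℝ (Fin 3)) (s₁ s₂ : EuclideanSpace ℝ (Fin 3))
    {σ σ' : ℤ → ℤ} (hσ : IsHaggSeq σ) (hσ' : IsHaggSeq σ') (h1 : σ 0 = 1) (h1' : σ' 0 = 1)
    (hsub₁ : (fun q => A₁ q + t₁) '' fccStacking 1 (Real.sqrt (2 / 3)) ⊆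
      (fun p => L p + s₁) '' barlowStacking 1 (Real.sqrt (2 / 3)) σ)
    (hsub₂ : (fun q => A₂ q + t₂) '' fccStacking 1 (Real.sqrt (2 / 3)) ⊆
      (fun p => L p + s₂) '' barlowStacking 1 (Real.sqrt (2 / 3)) σ')
    (X : Finset (EuclideanSpace ℝ (Fin 3)))
    (hX : ∀ p ∈ X, ∀ q ∈ X, p ≠ q → 1 ≤ dist p q)
    (hrigid : ∀ p ∈ X, p ∈ (fun q => A₁ q + t₁) '' fccStacking 1 (Real.sqrt (2 / 3)) ∨
      p ∈ (fun q => A₂ q + t₂) '' fccStacking 1 (Real.sqrt (2 / 3)))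
    (R₀ h ρ : ℝ) (hR₀ : 3 ≤ R₀) (hh : 0 ≤ h) (hρ : R₀ ≤ ρ)
    (hP₁ : ∀ p ∈ (fun q => A₁ q + t₁) '' fccStacking 1 (Real.sqrt (2 / 3)),
      -(2 * R₀) ≤ p 2 → p 2 ≤ -R₀ → p 0 ^ 2 + p 1 ^ 2 ≤ ρ ^ 2 → p ∈ X)
    (hP₂ : ∀ p ∈ (fun q => A₂ q + t₂) '' fccStacking 1 (Real.sqrt (2 / 3)),
      h + R₀ ≤ p 2 → p 2 ≤ h + 2 * R₀ → p 0 ^ 2 + p 1 ^ 2 ≤ ρ ^ 2 → p ∈ X)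
    (hdisj : ∀ p ∈ (fun q => A₁ q + t₁) '' fccStacking 1 (Real.sqrt (2 / 3)),
      p ∉ (fun q => A₂ q + t₂) '' fccStacking 1 (Real.sqrt (2 / 3)))
    (haxis : ∀ w₁ ∈ fccSlots, ∀ w₂ ∈ fccSlots, ∀ w₃ ∈ fccSlots,
      dist w₁ w₂ = 1 → dist w₁ w₃ = 1 → dist w₂ w₃ = 1 → w₁ 2 = 0 →
      (2 / 3 : ℝ) • (w₁ + w₂ + w₃) - L.symm (s₂ - s₁) ∉ fccStacking 1 (Real.sqrt (2 / 3)))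
    (haxis' : ∀ w₁ ∈ fccSlots, ∀ w₂ ∈ fccSlots, ∀ w₃ ∈ fccSlots,
      dist w₁ w₂ = 1 → dist w₁ w₃ = 1 → dist w₂ w₃ = 1 → w₁ 2 = 0 →
      (2 / 3 : ℝ) • (w₁ + w₂ + w₃) - L.symm (s₁ - s₂) ∉ fccStacking 1 (Real.sqrt (2 / 3))) :
    2 * (Real.sqrt 6 * Real.sqrt (1 - ⟪L (EuclideanSpace.single (2 : Fin 3) (1 : ℝ)),
        EuclideanSpace.single (2 : Fin 3) (1 : ℝ)⟫_ℝ ^ 2) * Real.pi * ρ ^ 2 -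
        3 * (Real.sqrt 2 * Real.pi * (6 * R₀ + 16) * (1 + h) * ρ)) ≤ 8 * contactDeficiency X := by
  classical
  have r₁ := coaxial_inPlane_vacancies A₁ t₁ A₂ t₂ L s₁ hσ hsub₁ X hX R₀ h ρ hR₀ hh hρ hP₁ hP₂ hdisj
  have r₂ := coaxial_inPlane_vacancies_top A₁ t₁ A₂ t₂ L s₂ hσ' hsub₂ X hX R₀ h ρ hR₀ hh hρ hP₁ hP₂
    hdisj
  have e₁ := coaxial_frame_eq_fcc_of_one A₁ t₁ L s₁ hσ hsub₁ h1
  have e₂ := coaxial_frame_eq_fcc_of_one A₂ t₂ L s₂ hσ' hsub₂ h1'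
  simp only [e₁, e₂] at r₁ r₂ hrigid hdisj
  have key := translate_inPlane_vacancies_le_eight_deficiency L s₁ s₂ X hX hrigid hdisj haxis haxis'
  linarith

end Summit.Ventures.Crystal3D.Theorems

end
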